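import Literature.NumberTheory.LFunctions.VinogradovKorobovZeroDetector
import HarnessLib

/-!
# The closed form of the Laplace transform of Ford's kernel at complex arguments (Ford 2002, (7.2)–(7.3); MTY (4.4))

Topic `Literature/NumberTheory/LFunctions`. Part of the decomposition of the explicit
Vinogradov–Korobov zero-free region of Mossinghoff–Trudgian–Yang (architecture in
`VinogradovKorobov.lean`). The in-tree assembly of MTY Lemma 4.7
(`zero_inequality_mossinghoff_trudgian_yang_of_ford`, `VinogradovKorobovZeroDetector.lean`) takes as
hypothesis `hker : ∀ θ ∈ (0, π/2), FordKernelFacts θ`, whose field `closed_form` is Ford's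
(7.2)–(7.3) = MTY (4.4): for `z ≠ 0`, `z² + tan²θ ≠ 0`,

  `W(z) = ∫₀^∞ e^{−zu} w(u) du = w(0)/z + W₀(z)`,
  `W₀(z) = c₀(c₂[(z+1)²e^{−2θ(cot θ) z} + z² − 1] − c₁z − c₃z³)/(z²(z² + tan²θ)²)`

("found with the aid of Maple"). This file PROVES it (`fordLaplaceWC_eq_closed_form`) for the
kernel DEFINED in Lean (`fordKernelW θ = g ⋆ g`), from the tree's explicit form of `w` on
`[0, 2θ cot θ]` (`fordKernelWExplicit`, `fordKernelW_eq_explicit`): `W(z) = ∫₀^{2θ cot θ} e^{−zu} w`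
(`fordLaplaceWC_eq_intervalIntegral`) is evaluated by the fundamental theorem of calculus with an
explicit antiderivative assembled from the five blocks `∫e^{−zu}cos(ku)`, `∫e^{−zu}sin(ku)`,
`∫ue^{−zu}cos(ku)`, `∫e^{−zu}`, `∫ue^{−zu}` (`k = tan θ`), and the resulting identity is verified
by the tangent half-angle substitution `sin θ = 2τ/(1+τ²)`, `cos θ = (1−τ²)/(1+τ²)`
(`τ = tan(θ/2)`), under which it is an exact rational identity in `τ, θ, z, e^{−2θ(cot θ)z}`.

No named fact is introduced; the only definitions are the antiderivative blocks.

## References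

* K. Ford, *Zero-free regions for the Riemann zeta function*, Number Theory for the Millennium II
  (2002), 25–56 = arXiv:1910.08205, (6.5), (7.2)–(7.3). (`Ford2002Millennium`)
* M. J. Mossinghoff, T. S. Trudgian, A. Yang, Res. Number Theory 10 (2024) = arXiv:2212.06867,
  (4.3)–(4.5). (`MossinghoffTrudgianYangRNT2024`)
-/

noncomputable section

open Complex Real MeasureTheory Set intervalIntegral

namespace Literature.NumberTheory.LFunctions

namespace FordKernelCF

/-! ## The antiderivative blocks -/

/-- `e^{−zu}` as a function of the real variable `u`. [folklore] -/
def ex (z : ℂ) (u : ℝ) : ℂ := Complex.exp (-(z * u))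

/-- `∫ e^{−zu} cos(ku) du = e^{−zu}(k sin(ku) − z cos(ku))/(z² + k²)`. [folklore] -/
def blkIc (z : ℂ) (k u : ℝ) : ℂ :=
  ex z u * (k * Real.sin (u * k) - z * Real.cos (u * k)) / (z ^ 2 + (k : ℂ) ^ 2)

/-- `∫ e^{−zu} sin(ku) du = −e^{−zu}(z sin(ku) + k cos(ku))/(z² + k²)`. [folklore] -/
def blkIs (z : ℂ) (k u : ℝ) : ℂ :=
  -(ex z u * (z * Real.sin (u * k) + k * Real.cos (u * k))) / (z ^ 2 + (k : ℂ) ^ 2)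

/-- `∫ u e^{−zu} cos(ku) du = u·Ic − (k Is − z Ic)/(z² + k²)`. [folklore] -/
def blkJc (z : ℂ) (k u : ℝ) : ℂ :=
  u * blkIc z k u - (k * blkIs z k u - z * blkIc z k u) / (z ^ 2 + (k : ℂ) ^ 2)

/-- `∫ e^{−zu} du = −e^{−zu}/z`. [folklore] -/
def blkI0 (z : ℂ) (u : ℝ) : ℂ := -ex z u / z

/-- `∫ u e^{−zu} du = −e^{−zu}(zu + 1)/z²`. [folklore] -/
def blkJ0 (z : ℂ) (u : ℝ) : ℂ := -(ex z u * (z * u + 1)) / z ^ 2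

/-- Derivative of `e^{−zu}`. [folklore] -/
theorem hasDerivAt_ex (z : ℂ) (u : ℝ) : HasDerivAt (ex z) (-z * ex z u) u := by
  have h0 : HasDerivAt (fun u : ℝ ↦ ((u : ℝ) : ℂ)) ((1 : ℝ) : ℂ) u := (hasDerivAt_id u).ofReal_comp
  have h1 : HasDerivAt (fun u : ℝ ↦ -(z * (u : ℂ))) (-(z * ((1 : ℝ) : ℂ))) u := (h0.const_mul z).fun_neg
  show HasDerivAt (fun u : ℝ ↦ Complex.exp (-(z * u))) (-z * Complex.exp (-(z * u))) u
  exact h1.cexp.congr_deriv (by push_cast; ring)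

/-- Derivative of `cos(uk)` (complex-valued). [folklore] -/
theorem hasDerivAt_cos_mul (k u : ℝ) :
    HasDerivAt (fun u : ℝ ↦ (Real.cos (u * k) : ℂ)) (-(k : ℂ) * Real.sin (u * k)) u := by
  have h : HasDerivAt (fun u : ℝ ↦ Real.cos (u * k)) (-Real.sin (u * k) * (1 * k)) u :=
    ((hasDerivAt_id u).mul_const k).cos
  exact h.ofReal_comp.congr_deriv (by push_cast; ring)

/-- Derivative of `sin(uk)` (complex-valued). [folklore] -/
theorem hasDerivAt_sin_mul (k u : ℝ) :
    HasDerivAt (fun u : ℝ ↦ (Real.sin (u * k) : ℂ)) ((k : ℂ) * Real.cos (u * k)) u := by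
  have h : HasDerivAt (fun u : ℝ ↦ Real.sin (u * k)) (Real.cos (u * k) * (1 * k)) u :=
    ((hasDerivAt_id u).mul_const k).sin
  exact h.ofReal_comp.congr_deriv (by push_cast; ring)

/-- `d/du Ic = e^{−zu} cos(ku)`. [folklore] -/
theorem hasDerivAt_blkIc {z : ℂ} {k : ℝ} (hz : z ^ 2 + (k : ℂ) ^ 2 ≠ 0) (u : ℝ) :
    HasDerivAt (blkIc z k) (ex z u * Real.cos (u * k)) u := by
  have h : HasDerivAt (fun u : ℝ ↦ ex z u * ((k : ℂ) * Real.sin (u * k) - z * Real.cos (u * k))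
      / (z ^ 2 + (k : ℂ) ^ 2)) _ u :=
    ((hasDerivAt_ex z u).fun_mul (((hasDerivAt_sin_mul k u).const_mul (k : ℂ)).fun_sub
      ((hasDerivAt_cos_mul k u).const_mul z))).div_const _
  show HasDerivAt (fun u : ℝ ↦ ex z u * ((k : ℂ) * Real.sin (u * k) - z * Real.cos (u * k))
      / (z ^ 2 + (k : ℂ) ^ 2)) _ u
  refine h.congr_deriv ?_
  field_simp
  ring

/-- `d/du Is = e^{−zu} sin(ku)`. [folklore] -/
theorem hasDerivAt_blkIs {z : ℂ} {k : ℝ} (hz : z ^ 2 + (k : ℂ) ^ 2 ≠ 0) (u : ℝ) :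
    HasDerivAt (blkIs z k) (ex z u * Real.sin (u * k)) u := by
  have h : HasDerivAt (fun u : ℝ ↦ -(ex z u * (z * Real.sin (u * k) + (k : ℂ) * Real.cos (u * k)))
      / (z ^ 2 + (k : ℂ) ^ 2)) _ u :=
    ((hasDerivAt_ex z u).fun_mul (((hasDerivAt_sin_mul k u).const_mul z).fun_add
      ((hasDerivAt_cos_mul k u).const_mul (k : ℂ)))).fun_neg.div_const _
  show HasDerivAt (fun u : ℝ ↦ -(ex z u * (z * Real.sin (u * k) + (k : ℂ) * Real.cos (u * k)))
      / (z ^ 2 + (k : ℂ) ^ 2)) _ u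
  refine h.congr_deriv ?_
  field_simp
  ring

/-- `d/du Jc = u e^{−zu} cos(ku)`. [folklore] -/
theorem hasDerivAt_blkJc {z : ℂ} {k : ℝ} (hz : z ^ 2 + (k : ℂ) ^ 2 ≠ 0) (u : ℝ) :
    HasDerivAt (blkJc z k) (u * (ex z u * Real.cos (u * k))) u := by
  have hu : HasDerivAt (fun u : ℝ ↦ ((u : ℝ) : ℂ)) ((1 : ℝ) : ℂ) u := (hasDerivAt_id u).ofReal_comp
  have h : HasDerivAt (fun u : ℝ ↦ (u : ℂ) * blkIc z k u
      - ((k : ℂ) * blkIs z k u - z * blkIc z k u) / (z ^ 2 + (k : ℂ) ^ 2)) _ u :=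
    (hu.fun_mul (hasDerivAt_blkIc hz u)).fun_sub
      ((((hasDerivAt_blkIs hz u).const_mul (k : ℂ)).fun_sub ((hasDerivAt_blkIc hz u).const_mul z)).div_const
        (z ^ 2 + (k : ℂ) ^ 2))
  show HasDerivAt (fun u : ℝ ↦ (u : ℂ) * blkIc z k u
      - ((k : ℂ) * blkIs z k u - z * blkIc z k u) / (z ^ 2 + (k : ℂ) ^ 2)) _ u
  refine h.congr_deriv ?_
  simp only [blkIc]
  push_cast
  field_simp
  ring

/-- `d/du I0 = e^{−zu}`. [folklore] -/
theorem hasDerivAt_blkI0 {z : ℂ} (hz : z ≠ 0) (u : ℝ) : HasDerivAt (blkI0 z) (ex z u) u := by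
  have h : HasDerivAt (fun u : ℝ ↦ -ex z u / z) _ u := ((hasDerivAt_ex z u).fun_neg).div_const z
  show HasDerivAt (fun u : ℝ ↦ -ex z u / z) _ u
  refine h.congr_deriv ?_
  field_simp

/-- `d/du J0 = u e^{−zu}`. [folklore] -/
theorem hasDerivAt_blkJ0 {z : ℂ} (hz : z ≠ 0) (u : ℝ) : HasDerivAt (blkJ0 z) (u * ex z u) u := by
  have h0 : HasDerivAt (fun u : ℝ ↦ ((u : ℝ) : ℂ)) ((1 : ℝ) : ℂ) u := (hasDerivAt_id u).ofReal_comp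
  have hu : HasDerivAt (fun u : ℝ ↦ z * (u : ℂ) + 1) (z * ((1 : ℝ) : ℂ)) u := (h0.const_mul z).add_const 1
  have h : HasDerivAt (fun u : ℝ ↦ -(ex z u * (z * (u : ℂ) + 1)) / z ^ 2) _ u :=
    (((hasDerivAt_ex z u).fun_mul hu).fun_neg).div_const (z ^ 2)
  show HasDerivAt (fun u : ℝ ↦ -(ex z u * (z * (u : ℂ) + 1)) / z ^ 2) _ u
  refine h.congr_deriv ?_
  push_cast
  field_simp
  ring

/-! ## The antiderivative of `e^{−zu} w(u)` on `[0, 2θ cot θ]` -/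

/-- The antiderivative `Φ(u)` of `e^{−zu} w(u)` built from the explicit form of `w`:
`w(u) = [(θ cot θ − cos²θ − u/2) cos(u tan θ) + (cos θ (2cos²θ + 1)/(2 sin θ)) sin(u tan θ)
+ cos²θ (2θ cot θ − 2 − u)]/cos⁴θ`. [folklore] -/
def blkPhi (θ : ℝ) (z : ℂ) (u : ℝ) : ℂ :=
  ((((θ * Real.cot θ - Real.cos θ ^ 2 : ℝ)) : ℂ) * blkIc z (Real.tan θ) u
    - (1 / 2 : ℂ) * blkJc z (Real.tan θ) u
    + ((Real.cos θ * (2 * Real.cos θ ^ 2 + 1) / (2 * Real.sin θ) : ℝ) : ℂ) * blkIs z (Real.tan θ) u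
    + ((Real.cos θ ^ 2 * (2 * (θ * Real.cot θ) - 2) : ℝ) : ℂ) * blkI0 z u
    - ((Real.cos θ ^ 2 : ℝ) : ℂ) * blkJ0 z u) / ((Real.cos θ ^ 4 : ℝ) : ℂ)

/-- `Φ' = e^{−zu} w(u)` (with `w` in its explicit form). [folklore] -/
theorem hasDerivAt_blkPhi (θ : ℝ) {z : ℂ} (hz0 : z ≠ 0) (hz : z ^ 2 + (Real.tan θ : ℂ) ^ 2 ≠ 0)
    (hc : Real.cos θ ≠ 0) (u : ℝ) :
    HasDerivAt (blkPhi θ z) (ex z u * (fordKernelWExplicit θ u : ℂ)) u := by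
  have h : HasDerivAt (fun u : ℝ ↦
      ((((θ * Real.cot θ - Real.cos θ ^ 2 : ℝ)) : ℂ) * blkIc z (Real.tan θ) u
        - (1 / 2 : ℂ) * blkJc z (Real.tan θ) u
        + ((Real.cos θ * (2 * Real.cos θ ^ 2 + 1) / (2 * Real.sin θ) : ℝ) : ℂ) * blkIs z (Real.tan θ) u
        + ((Real.cos θ ^ 2 * (2 * (θ * Real.cot θ) - 2) : ℝ) : ℂ) * blkI0 z u
        - ((Real.cos θ ^ 2 : ℝ) : ℂ) * blkJ0 z u) / ((Real.cos θ ^ 4 : ℝ) : ℂ)) _ u :=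
    ((((((hasDerivAt_blkIc hz u).const_mul _).fun_sub ((hasDerivAt_blkJc hz u).const_mul (1 / 2 : ℂ))).fun_add
      ((hasDerivAt_blkIs hz u).const_mul _)).fun_add ((hasDerivAt_blkI0 hz0 u).const_mul _)).fun_sub
        ((hasDerivAt_blkJ0 hz0 u).const_mul _)).div_const _
  show HasDerivAt (fun u : ℝ ↦
      ((((θ * Real.cot θ - Real.cos θ ^ 2 : ℝ)) : ℂ) * blkIc z (Real.tan θ) u
        - (1 / 2 : ℂ) * blkJc z (Real.tan θ) u
        + ((Real.cos θ * (2 * Real.cos θ ^ 2 + 1) / (2 * Real.sin θ) : ℝ) : ℂ) * blkIs z (Real.tan θ) u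
        + ((Real.cos θ ^ 2 * (2 * (θ * Real.cot θ) - 2) : ℝ) : ℂ) * blkI0 z u
        - ((Real.cos θ ^ 2 : ℝ) : ℂ) * blkJ0 z u) / ((Real.cos θ ^ 4 : ℝ) : ℂ)) _ u
  refine h.congr_deriv ?_
  have hc' : ((Real.cos θ : ℝ) : ℂ) ≠ 0 := Complex.ofReal_ne_zero.2 hc
  unfold fordKernelWExplicit
  push_cast
  field_simp
  ring

end FordKernelCF

open FordKernelCF

section closedform

variable {θ : ℝ} (hθ : 0 < θ) (hθ' : θ < π / 2)
include hθ hθ'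

/-- `W(z) = Φ(2θ cot θ) − Φ(0)` (the fundamental theorem of calculus on `[0, 2θ cot θ]`, where
`w` is given by its explicit form). [cite: Ford2002Millennium, (7.2)] -/
theorem fordLaplaceWC_eq_blkPhi_sub {z : ℂ} (hz0 : z ≠ 0) (hz : z ^ 2 + (Real.tan θ : ℂ) ^ 2 ≠ 0) :
    fordLaplaceWC θ z = blkPhi θ z (2 * (θ * Real.cot θ)) - blkPhi θ z 0 := by
  have ha := ford_cot_pos hθ hθ'
  rw [fordLaplaceWC_eq_intervalIntegral ha.le]
  have hcongr : ∫ u in (0 : ℝ)..(2 * (θ * Real.cot θ)), Complex.exp (-(z * u)) * (fordKernelW θ u : ℂ)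
      = ∫ u in (0 : ℝ)..(2 * (θ * Real.cot θ)), ex z u * (fordKernelWExplicit θ u : ℂ) := by
    refine intervalIntegral.integral_congr fun u hu ↦ ?_
    rw [Set.uIcc_of_le (by positivity)] at hu
    simp only [ex]
    rw [fordKernelW_eq_explicit hθ hθ' hu.1 hu.2]
  rw [hcongr]
  refine intervalIntegral.integral_eq_sub_of_hasDerivAt
    (fun u _ ↦ hasDerivAt_blkPhi θ hz0 hz (ford_cos_pos hθ hθ').ne' u) ?_
  refine (Continuous.intervalIntegrable ?_ _ _)
  unfold ex fordKernelWExplicit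
  fun_prop

/-- Tangent half-angle data on `(0, π/2)`: `τ = tan(θ/2) ∈ (0, 1)`, `sin θ = 2τ/(1+τ²)`,
`cos θ = (1−τ²)/(1+τ²)`, `tan θ = 2τ/(1−τ²)`, `cot θ = (1−τ²)/(2τ)`. [folklore] -/
theorem tan_half_data :
    0 < Real.tan (θ / 2) ∧ Real.tan (θ / 2) < 1 ∧
      Real.sin θ = 2 * Real.tan (θ / 2) / (1 + Real.tan (θ / 2) ^ 2) ∧
      Real.cos θ = (1 - Real.tan (θ / 2) ^ 2) / (1 + Real.tan (θ / 2) ^ 2) ∧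
      Real.tan θ = 2 * Real.tan (θ / 2) / (1 - Real.tan (θ / 2) ^ 2) ∧
      Real.cot θ = (1 - Real.tan (θ / 2) ^ 2) / (2 * Real.tan (θ / 2)) := by
  have hpi := Real.pi_pos
  have h0 : 0 < Real.tan (θ / 2) := Real.tan_pos_of_pos_of_lt_pi_div_two (by linarith) (by linarith)
  have h1 : Real.tan (θ / 2) < 1 := by
    rw [← Real.tan_pi_div_four]
    exact Real.tan_lt_tan_of_lt_of_lt_pi_div_two (by linarith) (by linarith) (by linarith)
  have hs := Real.sin_eq_two_mul_tan_half_div_one_add_tan_half_sq θ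
  have hc := Real.cos_eq_two_mul_tan_half_div_one_sub_tan_half_sq θ
    (by have := ford_cos_pos hθ hθ'; linarith)
  have ht := Real.tan_eq_one_sub_tan_half_sq_div_one_add_tan_half_sq θ
  refine ⟨h0, h1, hs, hc, ht, ?_⟩
  rw [Real.cot_eq_cos_div_sin, hc, hs]
  have h2 : (1 : ℝ) + Real.tan (θ / 2) ^ 2 ≠ 0 := by positivity
  field_simp

/-- **The algebraic identity**: `Φ(2θ cot θ) − Φ(0) = w(0)/z + W₀(z)` (Ford (7.2)–(7.3) for the
explicit antiderivative; verified by the tangent half-angle substitution).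
[cite: Ford2002Millennium, (7.2)–(7.3)] -/
theorem blkPhi_sub_eq {z : ℂ} (hz0 : z ≠ 0) (hz : z ^ 2 + (Real.tan θ : ℂ) ^ 2 ≠ 0) :
    blkPhi θ z (2 * (θ * Real.cot θ)) - blkPhi θ z 0 = (fordSmoothW0 θ : ℂ) / z + fordLaplaceW0 θ z := by
  obtain ⟨hτ0, hτ1, hS, hC, hT, hCot⟩ := tan_half_data hθ hθ'
  have hs := ford_sin_pos hθ hθ'
  have hc := ford_cos_pos hθ hθ'
  have hs' : ((Real.sin θ : ℝ) : ℂ) ≠ 0 := Complex.ofReal_ne_zero.2 hs.ne'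
  have hc' : ((Real.cos θ : ℝ) : ℂ) ≠ 0 := Complex.ofReal_ne_zero.2 hc.ne'
  -- trigonometric values at `u = 2θ cot θ`
  have hL : 2 * (θ * Real.cot θ) * Real.tan θ = 2 * θ := by
    have := ford_cot_mul_tan hθ hθ'
    linear_combination 2 * this
  have hsinL : Real.sin (2 * (θ * Real.cot θ) * Real.tan θ) = 2 * Real.sin θ * Real.cos θ := by
    rw [hL, Real.sin_two_mul]
  have hcosL : Real.cos (2 * (θ * Real.cot θ) * Real.tan θ) = 2 * Real.cos θ ^ 2 - 1 := by
    rw [hL, Real.cos_two_mul]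
  -- the two spellings of the exponential
  have hX : Complex.exp (-((((2 * θ * Real.cot θ : ℝ)) : ℂ) * z))
      = Complex.exp (-(z * ((2 * (θ * Real.cot θ) : ℝ) : ℂ))) := by
    congr 1; push_cast; ring
  unfold blkPhi blkJc blkIc blkIs blkI0 blkJ0 ex fordLaplaceW0 fordSmoothW0 fordC₀ fordC₁ fordC₂ fordC₃
  rw [hX]
  simp only [hsinL, hcosL, zero_mul, Real.sin_zero, Real.cos_zero, Complex.ofReal_zero,
    mul_zero, neg_zero, Complex.exp_zero]
  generalize Complex.exp (-(z * ((2 * (θ * Real.cot θ) : ℝ) : ℂ))) = X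
  -- stage 1: clear denominators with `sin θ, cos θ, tan θ, cot θ` as opaque real atoms
  generalize hSg : Real.sin θ = S at hS hs' ⊢
  generalize hCg : Real.cos θ = C at hC hc' ⊢
  generalize hTg : Real.tan θ = T at hT hz ⊢
  generalize hKg : Real.cot θ = K at hCot ⊢
  push_cast at hz ⊢
  field_simp
  -- stage 2: the tangent half-angle substitution (an exact rational identity in `τ, θ, z, X`)
  have hτ0' : ((Real.tan (θ / 2) : ℝ) : ℂ) ≠ 0 := Complex.ofReal_ne_zero.2 hτ0.ne'
  have h1p : (1 : ℂ) + (Real.tan (θ / 2) : ℂ) ^ 2 ≠ 0 := by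
    have : (0 : ℝ) < 1 + Real.tan (θ / 2) ^ 2 := by positivity
    exact_mod_cast this.ne'
  have h1m : (1 : ℂ) - (Real.tan (θ / 2) : ℂ) ^ 2 ≠ 0 := by
    have : (0 : ℝ) < 1 - Real.tan (θ / 2) ^ 2 := by nlinarith
    exact_mod_cast this.ne'
  rw [hS, hC, hT, hCot]
  generalize hτg : Real.tan (θ / 2) = τ at hτ0' h1p h1m ⊢
  push_cast
  field_simp
  ring

/-- **Ford (7.2)–(7.3) = MTY (4.4): `W(z) = w(0)/z + W₀(z)`** for `z ≠ 0`, `z² + tan²θ ≠ 0`, for the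
kernel `w = g ⋆ g` defined in Lean — the `closed_form` field of `FordKernelFacts θ`.
[cite: Ford2002Millennium, (7.2)–(7.3)] [cite: MossinghoffTrudgianYangRNT2024, (4.4)] -/
theorem fordLaplaceWC_eq_closed_form {z : ℂ} (hz0 : z ≠ 0) (hz : z ^ 2 + (Real.tan θ : ℂ) ^ 2 ≠ 0) :
    fordLaplaceWC θ z = (fordSmoothW0 θ : ℂ) / z + fordLaplaceW0 θ z := by
  rw [fordLaplaceWC_eq_blkPhi_sub hθ hθ' hz0 hz, blkPhi_sub_eq hθ hθ' hz0 hz]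

end closedform

end Literature.NumberTheory.LFunctions
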